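import Summits.ABC.IUTFork.Conditional.AbcOfCor312SlackSharp
import Literature.IUT.LogVolume.Corollary22PartIIDisplayWindow
import HarnessLib

/-!
# The Σ-VARIANT INSIDE THE (P1) WINDOW: the weakened Corollary is needed only at admissible `(P, l)` with `log(q^∀)^{1/2} ≤ l` and
# `log(q^∀) > 2^140` — and there a RELATIVE off-Σ remainder `ε ≤ ρ(P,l)·gap(T)` with `ρ(P,l) := 30·d*_mod/l = 1.66·10⁷·d_mod/l` costs NOTHING

PROOF-ONLY sequel (no `def`, no new `Prop`, no instance, no notation) of this seat's `Conditional/AbcOfCor312SlackSharp.lean` (p471097; `c♯(l)`,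
`display_of_squeezeIII_slack_of_le_sharp`) and of `Literature/IUT/LogVolume/Corollary22PartIIDisplayWindow.lean` (`Cor22.partII_of_displayWindow`: the
proof of record of [IUTchIV] Cor. 2.2 (ii) consumes Thm. 1.10's display only at the (P1)–(P3) prime, `log(q^∀)^{1/2} ≤ l ≤ 10δ·log(q^∀)^{1/2}·log(2δ·log(q^∀))`,
and only outside `Exc_d`, `log(q^∀) > 2^140`). R-H ROUND 2 seat abc-iut-rh2-q2-cond; rh-lead's pre-registered bins for the rows-3/4/5 word
(ROUND2/START-HERE §R3: `ρ = E_off⁺/gap`; «`0 < ρ ≤ 1/l`: exponent kept, constant worse · `1/l < ρ < 1`: exponent ×1/(1−ρ) · `ρ ≥ 1`: squeeze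
empty»). TAKES NO SIDE on [IUTchIII] Cor. 3.12 or on any author. S. Mochizuki, *Inter-universal Teichmüller theory IV* (RIMS Apr. 2020 = PRIMS
**57** (2021)), Thm. 1.10 pp. 22–31, Cor. 2.2 (ii) pp. 41–48, (P1) p. 45 [claim: Mochizuki2012, status: disputed].

WHAT IS TYPED (`d* = 2^{12}·3^3·5·d_mod`, `c♯(l) = 20·(1 − 12/l²) − 84/9 ≥ 5` for `l ≥ 7`, `gap(T) = ((l+1)/24 − 1/(2l))·log(q^{∤{2,l}})`):
* **`ABC_of_cor312Slack_window_of_hullRegime`** — [NUMΣ-W] the weakened number-level Corollary `T.negAbsLogQ ≤ T.negLogTheta + ε P l T` demanded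
  ONLY at admissible `(P, l)` with `2^140 < log(q^∀(P))` and `log(q^∀(P))^{1/2} ≤ l` · [TOL♯-W] `ε P l T ≤ ((l+1)/4)·c♯(l)·d*·l` there · [CONE] `hreg`
  verbatim ⟹ `ABC` (print's constants; `Cor22.partII_of_displayWindow` at `η₀` of Prop. 1.6);
* `ABC_of_cor312Slack_windowFull_of_hullRegime` — the same with the FULL two-sided (P1) window and the degree bound `d` of Cor. 2.2 (ii)
  (`√h ≤ l ≤ 10δ_d·√h·log(2δ_d·h)`, `P.degree ≤ d`) — exactly the `(P, l)` at which print applies Thm. 1.10;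
* **`ABC_of_cor312Slack_rho_of_hullRegime`** — the same with the RELATIVE tolerance [TOL-ρ] `ε P l T ≤ (30·d*/l)·T.gap`: inside the window
  `log(q^{∤{2,l}}) ≤ log(q^∀) ≤ l²`, so `(30·d*/l)·gap ≤ (30·d*/l)·((l+1)/24)·l² = ((l+1)/4)·5·d*·l ≤ Tol♯` (`gap_le_window`).
READING (numbers, for the lead's bins): in the kernel the «no loss at all» bin is not `ρ = 0` but **`ρ ≤ 30·d*_mod/l = 16 588 800·d_mod/l`**
(sharp: `6·c♯(l)·d*/l`, `≈ 1.91·10⁷·d_mod/l` at `l = 7`, `→ 3.5·10⁷·d_mod/l`), PROVIDED the weakened Corollary is asked only inside the (P1) window —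
which is all the proof of Cor. 2.2 (ii) ever uses. A fixed `ρ` not decaying like `1/l` is outside this file (exponent loss). For Q3 («genuine data in
Σ for `l ≫ 0`?») the same window is the comparison scale: the certificate needs the datum's stratum/remainder only for primes `l ≥ log(q^∀)^{1/2}`
(`> 2^70`). HONEST FRAMING: conditional on assumption labels for the disputed inequality; nothing asserts abc, Thm. 1.10 or Cor. 3.12; typed ≠
proved; instantiated ≠ endorsed. [cite: Mochizuki2012, IUTchIV Thm. 1.10 pp. 22–31; Cor. 2.2 (ii) pp. 41–48, (P1) p. 45]
[cite: Mochizuki2012, IUTchIII Cor. 3.12 p. 174] [claim: Mochizuki2012, status: disputed]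
-/

noncomputable section

namespace Summit.ABC.IUTFork.Conditional.Cor312Slack

open Literature.IUT.LogVolume Literature.IUT.HodgeTheaters Literature.NumberTheory.DiophantineGeometry.GenEll
open Summit.ABC.ABC.Theorems NumberField IsDedekindDomain

variable {P : NFPoint} {l : ℕ}

/-- **The gap inside the (P1) window**: at a genuine datum `T` of `(P, l)` with `λ ∈ U_X` and `log(q^∀(P))^{1/2} ≤ l`,
`gap(T) = ((l+1)/24 − 1/(2l))·log(q^{∤{2,l}}) ≤ ((l+1)/24)·l²` (`log(q^{∤{2,l}}) ≤ log(q^∀) ≤ l²`, `Cor22.logQAvoid_anti`, `PointDict.gap_eq`).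
[cite: Mochizuki2012, IUTchIV Cor. 2.2 (ii) (P1) p. 45] [claim: Mochizuki2012, status: disputed] -/
theorem gap_le_window (T : Cor22.ThetaVolumeDatumAt P l) (hU : P.InU) (hlo : Real.sqrt (Cor22.logQForall P) ≤ l) :
    T.gap ≤ ((l : ℝ) + 1) / 24 * (l : ℝ) ^ 2 := by
  have hl0 : (0 : ℝ) ≤ l := Nat.cast_nonneg l
  have hh0 : 0 ≤ Cor22.logQForall P := Cor22.logQAvoid_nonneg P ∅
  have hQ0 : 0 ≤ Cor22.logQAvoid P {2, l} := Cor22.logQAvoid_nonneg P {2, l}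
  have hQh : Cor22.logQAvoid P {2, l} ≤ Cor22.logQForall P := Cor22.logQAvoid_anti P (Finset.empty_subset _)
  have hhl : Cor22.logQForall P ≤ (l : ℝ) ^ 2 := by
    have h1 : Real.sqrt (Cor22.logQForall P) ^ 2 = Cor22.logQForall P := Real.sq_sqrt hh0
    have h2 : Real.sqrt (Cor22.logQForall P) ^ 2 ≤ (l : ℝ) ^ 2 := by
      nlinarith [Real.sqrt_nonneg (Cor22.logQForall P), hlo]
    linarith
  rw [PointDict.gap_eq T hU]
  have hcoef : ((l : ℝ) + 1) / 24 - 1 / (2 * l) ≤ ((l : ℝ) + 1) / 24 := by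
    have : (0 : ℝ) ≤ 1 / (2 * l) := by positivity
    linarith
  calc (((l : ℝ) + 1) / 24 - 1 / (2 * l)) * Cor22.logQAvoid P {2, l}
      ≤ ((l : ℝ) + 1) / 24 * Cor22.logQAvoid P {2, l} := mul_le_mul_of_nonneg_right hcoef hQ0
    _ ≤ ((l : ℝ) + 1) / 24 * (l : ℝ) ^ 2 := mul_le_mul_of_nonneg_left (le_trans hQh hhl) (by positivity)

/-- **`abc` FROM THE WEAKENED COROLLARY INSIDE THE (P1) WINDOW with the sharp `η`-free tolerance and the cone binder**: [NUMΣ-W]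
`−|log(q)| ≤ −|log(Θ)| + ε(P,l,T)` at every genuine Θ-volume datum of every admissible `(P, l)` WITH `2^140 < log(q^∀(P))` AND `log(q^∀(P))^{1/2} ≤ l`
(ASSUMPTION LABEL), [TOL♯-W] `ε(P,l,T) ≤ ((l+1)/4)·(20·(1 − 12/l²) − 84/9)·d*_mod·l` there, [CONE] `hreg` verbatim ⟹ `ABC` with print's constants —
via `Cor22.partII_of_displayWindow` (display at `η₀` of Prop. 1.6 from the slack squeeze and `display_of_squeezeIII_slack_of_le_sharp`; datum by
`ThetaPartII.stub_thetaData`, hull estimate by `ThetaPartII.hullVolume_of_hullRegime`, `l ≠ 5` by abc-iut-S-d1's theta field), `Cor22.fullGaloisImage_holds`,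
`closes`, `genEllTwo_holds`, `JInvWlog_proof`. CONDITIONAL; nothing is asserted about the hypotheses; no side taken.
[cite: Mochizuki2012, IUTchIV Cor. 2.2–2.3 pp. 41–55, (P1) p. 45] [cite: Mochizuki2012, IUTchIII Cor. 3.12 p. 174] [claim: Mochizuki2012, status: disputed] -/
theorem ABC_of_cor312Slack_window_of_hullRegime
    (ε : ∀ (P : NFPoint) (l : ℕ), Cor22.ThetaVolumeDatumAt P l → ℝ)
    (h312w : ∀ P : NFPoint, P ∈ UP → ∀ l : ℕ, l.Prime → 5 ≤ l →
      Cor22.AdmitsCore P → Cor22.CondP2 P l → Cor22.CondP5 P l → Cor22.CondP6 P l →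
      (2 : ℝ) ^ 140 < Cor22.logQForall P → Real.sqrt (Cor22.logQForall P) ≤ l →
      ∀ T : Cor22.ThetaVolumeDatumAt P l, T.negAbsLogQ ≤ T.negLogTheta + ε P l T)
    (hTolw : ∀ P : NFPoint, P ∈ UP → ∀ l : ℕ, l.Prime → 5 ≤ l →
      Cor22.AdmitsCore P → Cor22.CondP2 P l → Cor22.CondP5 P l → Cor22.CondP6 P l →
      (2 : ℝ) ^ 140 < Cor22.logQForall P → Real.sqrt (Cor22.logQForall P) ≤ l →
      ∀ T : Cor22.ThetaVolumeDatumAt P l,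
        ε P l T ≤ ((l : ℝ) + 1) / 4 * ((20 * (1 - 12 / (l : ℝ) ^ 2) - 84 / 9) * ((((2 ^ 12 * 3 ^ 3 * 5 * Cor22.dmod P : ℕ) : ℝ)) * l)))
    (hreg : ∀ P : NFPoint, P ∈ UP → ∀ l : ℕ, l.Prime → 5 ≤ l →
      Cor22.AdmitsCore P → Cor22.CondP2 P l → Cor22.CondP5 P l → Cor22.CondP6 P l →
      ∀ T : Cor22.ThetaVolumeDatumAt P l,
        (letI := T.instFieldF; letI := T.instNumberFieldF; letI := T.instAlgebraF; letI := T.instFieldK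
         letI := T.instNumberFieldK; letI := T.instAlgebraK; letI := T.instFieldFbar; letI := T.instAlgebraFbar
         letI := T.instAlgebraKFbar; letI := T.instIsElliptic
         ¬ (∀ p ∈ T.I.supportPrimes, ∀ v w : placesOver (fieldOfModuli T.E) p,
            (Summit.ABC.IUTFork.DHData.ofInput T.I).logQloc p v = (Summit.ABC.IUTFork.DHData.ofInput T.I).logQloc p w)) →
        T.HullEstimateOf
          (((l : ℝ) + 1) / 4 *
            ((1 + 12 * (Cor22.dmod P : ℝ) / l) * (P.logDiff + Cor22.logCondAvoid P {2, l})
              + 2 * Real.log l + 52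
              + 20 / 3 * Real.log (((2 ^ 12 * 3 ^ 3 * 5 * Cor22.dmod P : ℕ) : ℝ) * (l : ℝ))
                * (Nat.primeCounting (2 ^ 12 * 3 ^ 3 * 5 * Cor22.dmod P * l) : ℝ)))) :
    _root_.ABC := by
  obtain ⟨η₀, hη₀⟩ := exists_isEtaPrm
  refine Summit.ABC.ABC.Theses.IUTThetaPilot.closes ?_ Summit.ABC.ABC.Theorems.genEllTwo_holds Summit.ABC.ABC.Theorems.JInvWlog_proof
  unfold Summit.ABC.ABC.Theses.IUTThetaPilot.ThetaPartII
  refine Cor22.exists_partII_of_displayWindow hη₀ (fun P hP d _ l hl h5 hcore hP2 hP5 h6 h140 hlo _ => ?_) Cor22.fullGaloisImage_holds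
  have hU : P.InU := hP.1
  have hne : l ≠ 5 := by
    rintro rfl
    obtain ⟨F, hNF, hF⟩ := Cor22.exists_isThetaField P hU
    haveI := hNF
    exact Cor22.not_condP6_five_of_isThetaField hU F hF h6
  have hl7 : (7 : ℝ) ≤ l := by exact_mod_cast seven_le_of_prime_of_ne_five hl h5 hne
  have hη0 : 0 < η₀ := hη₀.1
  obtain ⟨T⟩ := ThetaPartII.stub_thetaData P hP l hl h5 hcore hP2 hP5 h6
  have hgap := logQAvoid_le_of_cor312Slack T hU (h312w P hP l hl h5 hcore hP2 hP5 h6 h140 hlo T)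
    (ThetaPartII.hullVolume_of_hullRegime hreg P hP l hl h5 hcore hP2 hP5 h6 T)
  refine display_of_squeezeIII_slack_of_le_sharp hl h5 hne hη₀ le_rfl (le_trans (hTolw P hP l hl h5 hcore hP2 hP5 h6 h140 hlo T) ?_) hgap
  have hc : (0 : ℝ) ≤ ((l : ℝ) + 1) / 4 := by positivity
  have hcS : (0 : ℝ) ≤ 20 * (1 - 12 / (l : ℝ) ^ 2) - 84 / 9 := le_trans (by norm_num) (five_le_sharpCoeff hl7)
  exact mul_le_mul_of_nonneg_left (mul_le_mul_of_nonneg_left (by linarith) hcS) hc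

/-- **`abc` FROM THE WEAKENED COROLLARY INSIDE THE (P1) WINDOW with a RELATIVE tolerance `ρ(P,l) = 30·d*_mod/l`**: [NUMΣ-W] as above,
[TOL-ρ] `ε(P,l,T) ≤ (30·d*/l)·gap(T)` at admissible `(P, l)` with `2^140 < log(q^∀)`, `log(q^∀)^{1/2} ≤ l`, [CONE] `hreg` verbatim ⟹ `ABC` with
print's constants: inside the window `(30·d*/l)·gap(T) ≤ (30·d*/l)·((l+1)/24)·l² = ((l+1)/4)·5·d*·l` (`gap_le_window`), a share of the sharp budget
(`five_le_sharpCoeff`). So the relative error class «`ρ = E_off⁺/gap ≤ C·d_mod/l`», `C = 30·2^{12}·3^3·5 = 16 588 800`, is absorbed with NO loss —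
not merely «exponent kept, constant worse». CONDITIONAL; nothing is asserted about the hypotheses; no side taken.
[cite: Mochizuki2012, IUTchIV Cor. 2.2–2.3 pp. 41–55, (P1) p. 45] [cite: Mochizuki2012, IUTchIII Cor. 3.12 p. 174] [claim: Mochizuki2012, status: disputed] -/
theorem ABC_of_cor312Slack_rho_of_hullRegime
    (ε : ∀ (P : NFPoint) (l : ℕ), Cor22.ThetaVolumeDatumAt P l → ℝ)
    (h312w : ∀ P : NFPoint, P ∈ UP → ∀ l : ℕ, l.Prime → 5 ≤ l →
      Cor22.AdmitsCore P → Cor22.CondP2 P l → Cor22.CondP5 P l → Cor22.CondP6 P l →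
      (2 : ℝ) ^ 140 < Cor22.logQForall P → Real.sqrt (Cor22.logQForall P) ≤ l →
      ∀ T : Cor22.ThetaVolumeDatumAt P l, T.negAbsLogQ ≤ T.negLogTheta + ε P l T)
    (hρ : ∀ P : NFPoint, P ∈ UP → ∀ l : ℕ, l.Prime → 5 ≤ l →
      Cor22.AdmitsCore P → Cor22.CondP2 P l → Cor22.CondP5 P l → Cor22.CondP6 P l →
      (2 : ℝ) ^ 140 < Cor22.logQForall P → Real.sqrt (Cor22.logQForall P) ≤ l →
      ∀ T : Cor22.ThetaVolumeDatumAt P l,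
        ε P l T ≤ 30 * (((2 ^ 12 * 3 ^ 3 * 5 * Cor22.dmod P : ℕ) : ℝ)) / l * T.gap)
    (hreg : ∀ P : NFPoint, P ∈ UP → ∀ l : ℕ, l.Prime → 5 ≤ l →
      Cor22.AdmitsCore P → Cor22.CondP2 P l → Cor22.CondP5 P l → Cor22.CondP6 P l →
      ∀ T : Cor22.ThetaVolumeDatumAt P l,
        (letI := T.instFieldF; letI := T.instNumberFieldF; letI := T.instAlgebraF; letI := T.instFieldK
         letI := T.instNumberFieldK; letI := T.instAlgebraK; letI := T.instFieldFbar; letI := T.instAlgebraFbar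
         letI := T.instAlgebraKFbar; letI := T.instIsElliptic
         ¬ (∀ p ∈ T.I.supportPrimes, ∀ v w : placesOver (fieldOfModuli T.E) p,
            (Summit.ABC.IUTFork.DHData.ofInput T.I).logQloc p v = (Summit.ABC.IUTFork.DHData.ofInput T.I).logQloc p w)) →
        T.HullEstimateOf
          (((l : ℝ) + 1) / 4 *
            ((1 + 12 * (Cor22.dmod P : ℝ) / l) * (P.logDiff + Cor22.logCondAvoid P {2, l})
              + 2 * Real.log l + 52
              + 20 / 3 * Real.log (((2 ^ 12 * 3 ^ 3 * 5 * Cor22.dmod P : ℕ) : ℝ) * (l : ℝ))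
                * (Nat.primeCounting (2 ^ 12 * 3 ^ 3 * 5 * Cor22.dmod P * l) : ℝ)))) :
    _root_.ABC := by
  refine ABC_of_cor312Slack_window_of_hullRegime ε h312w (fun P hP l hl h5 hcore hP2 hP5 h6 h140 hlo T => ?_) hreg
  have hU : P.InU := hP.1
  have hne : l ≠ 5 := by
    rintro rfl
    obtain ⟨F, hNF, hF⟩ := Cor22.exists_isThetaField P hU
    haveI := hNF
    exact Cor22.not_condP6_five_of_isThetaField hU F hF h6
  have hl7 : (7 : ℝ) ≤ l := by exact_mod_cast seven_le_of_prime_of_ne_five hl h5 hne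
  have hl0 : (0 : ℝ) < l := by linarith
  have hd1 : (1 : ℝ) ≤ (Cor22.dmod P : ℝ) := by exact_mod_cast Cor22.dmod_pos P
  have hD0 : (0 : ℝ) ≤ (((2 ^ 12 * 3 ^ 3 * 5 * Cor22.dmod P : ℕ) : ℝ)) := Nat.cast_nonneg _
  have hg := gap_le_window T hU hlo
  have hκ0 : (0 : ℝ) ≤ 30 * (((2 ^ 12 * 3 ^ 3 * 5 * Cor22.dmod P : ℕ) : ℝ)) / l := by positivity
  refine le_trans (hρ P hP l hl h5 hcore hP2 hP5 h6 h140 hlo T) ?_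
  calc 30 * (((2 ^ 12 * 3 ^ 3 * 5 * Cor22.dmod P : ℕ) : ℝ)) / l * T.gap
      ≤ 30 * (((2 ^ 12 * 3 ^ 3 * 5 * Cor22.dmod P : ℕ) : ℝ)) / l * (((l : ℝ) + 1) / 24 * (l : ℝ) ^ 2) := mul_le_mul_of_nonneg_left hg hκ0
    _ = ((l : ℝ) + 1) / 4 * (5 * ((((2 ^ 12 * 3 ^ 3 * 5 * Cor22.dmod P : ℕ) : ℝ)) * l)) := by
        field_simp
        ring
    _ ≤ ((l : ℝ) + 1) / 4 * ((20 * (1 - 12 / (l : ℝ) ^ 2) - 84 / 9) * ((((2 ^ 12 * 3 ^ 3 * 5 * Cor22.dmod P : ℕ) : ℝ)) * l)) := by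
        have hc : (0 : ℝ) ≤ ((l : ℝ) + 1) / 4 := by positivity
        have hDl : (0 : ℝ) ≤ (((2 ^ 12 * 3 ^ 3 * 5 * Cor22.dmod P : ℕ) : ℝ)) * l := by positivity
        exact mul_le_mul_of_nonneg_left (mul_le_mul_of_nonneg_right (five_le_sharpCoeff hl7) hDl) hc

/-- **`abc` from the weakened Corollary demanded EXACTLY where [IUTchIV] Cor. 2.2 (ii) applies Thm. 1.10** — the FULL (P1) window with the
degree bound `d` of the statement: [NUMΣ-W′] `−|log(q)| ≤ −|log(Θ)| + ε(P,l,T)` at admissible `(P, l)` with `P.degree ≤ d`, `2^140 < log(q^∀(P))`,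
`log(q^∀(P))^{1/2} ≤ l ≤ 10δ_d·log(q^∀(P))^{1/2}·log(2δ_d·log(q^∀(P)))` (`δ_d = 2^{12}·3^3·5·d`, `Cor22.delta`) · [TOL♯-W′] `ε ≤ ((l+1)/4)·c♯(l)·d*·l` there ·
[CONE] `hreg` verbatim ⟹ `ABC` with print's constants (`Cor22.partII_of_displayWindow` with all three window facts). The two-sided window is the
comparison scale for Q3 («datum ∈ Σ for `l ≫ 0`?»): per point only the primes `l ∈ [√h, 10δ_d·√h·log(2δ_d·h)]`, `h = log(q^∀) > 2^140`, are asked.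
CONDITIONAL; nothing is asserted about the hypotheses; no side taken. [cite: Mochizuki2012, IUTchIV Cor. 2.2 (ii) pp. 41–48, (P1) p. 45]
[cite: Mochizuki2012, IUTchIII Cor. 3.12 p. 174] [claim: Mochizuki2012, status: disputed] -/
theorem ABC_of_cor312Slack_windowFull_of_hullRegime
    (ε : ∀ (P : NFPoint) (l : ℕ), Cor22.ThetaVolumeDatumAt P l → ℝ)
    (h312w : ∀ P : NFPoint, P ∈ UP → ∀ d : ℕ, P.degree ≤ d → ∀ l : ℕ, l.Prime → 5 ≤ l →
      Cor22.AdmitsCore P → Cor22.CondP2 P l → Cor22.CondP5 P l → Cor22.CondP6 P l →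
      (2 : ℝ) ^ 140 < Cor22.logQForall P → Real.sqrt (Cor22.logQForall P) ≤ l →
      (l : ℝ) ≤ 10 * Cor22.delta d * Real.sqrt (Cor22.logQForall P) * Real.log (2 * Cor22.delta d * Cor22.logQForall P) →
      ∀ T : Cor22.ThetaVolumeDatumAt P l, T.negAbsLogQ ≤ T.negLogTheta + ε P l T)
    (hTolw : ∀ P : NFPoint, P ∈ UP → ∀ d : ℕ, P.degree ≤ d → ∀ l : ℕ, l.Prime → 5 ≤ l →
      Cor22.AdmitsCore P → Cor22.CondP2 P l → Cor22.CondP5 P l → Cor22.CondP6 P l →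
      (2 : ℝ) ^ 140 < Cor22.logQForall P → Real.sqrt (Cor22.logQForall P) ≤ l →
      (l : ℝ) ≤ 10 * Cor22.delta d * Real.sqrt (Cor22.logQForall P) * Real.log (2 * Cor22.delta d * Cor22.logQForall P) →
      ∀ T : Cor22.ThetaVolumeDatumAt P l,
        ε P l T ≤ ((l : ℝ) + 1) / 4 * ((20 * (1 - 12 / (l : ℝ) ^ 2) - 84 / 9) * ((((2 ^ 12 * 3 ^ 3 * 5 * Cor22.dmod P : ℕ) : ℝ)) * l)))
    (hreg : ∀ P : NFPoint, P ∈ UP → ∀ l : ℕ, l.Prime → 5 ≤ l →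
      Cor22.AdmitsCore P → Cor22.CondP2 P l → Cor22.CondP5 P l → Cor22.CondP6 P l →
      ∀ T : Cor22.ThetaVolumeDatumAt P l,
        (letI := T.instFieldF; letI := T.instNumberFieldF; letI := T.instAlgebraF; letI := T.instFieldK
         letI := T.instNumberFieldK; letI := T.instAlgebraK; letI := T.instFieldFbar; letI := T.instAlgebraFbar
         letI := T.instAlgebraKFbar; letI := T.instIsElliptic
         ¬ (∀ p ∈ T.I.supportPrimes, ∀ v w : placesOver (fieldOfModuli T.E) p,
            (Summit.ABC.IUTFork.DHData.ofInput T.I).logQloc p v = (Summit.ABC.IUTFork.DHData.ofInput T.I).logQloc p w)) →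
        T.HullEstimateOf
          (((l : ℝ) + 1) / 4 *
            ((1 + 12 * (Cor22.dmod P : ℝ) / l) * (P.logDiff + Cor22.logCondAvoid P {2, l})
              + 2 * Real.log l + 52
              + 20 / 3 * Real.log (((2 ^ 12 * 3 ^ 3 * 5 * Cor22.dmod P : ℕ) : ℝ) * (l : ℝ))
                * (Nat.primeCounting (2 ^ 12 * 3 ^ 3 * 5 * Cor22.dmod P * l) : ℝ)))) :
    _root_.ABC := by
  obtain ⟨η₀, hη₀⟩ := exists_isEtaPrm
  refine Summit.ABC.ABC.Theses.IUTThetaPilot.closes ?_ Summit.ABC.ABC.Theorems.genEllTwo_holds Summit.ABC.ABC.Theorems.JInvWlog_proof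
  unfold Summit.ABC.ABC.Theses.IUTThetaPilot.ThetaPartII
  refine Cor22.exists_partII_of_displayWindow hη₀ (fun P hP d hPd l hl h5 hcore hP2 hP5 h6 h140 hlo hhi => ?_) Cor22.fullGaloisImage_holds
  have hU : P.InU := hP.1
  have hne : l ≠ 5 := by
    rintro rfl
    obtain ⟨F, hNF, hF⟩ := Cor22.exists_isThetaField P hU
    haveI := hNF
    exact Cor22.not_condP6_five_of_isThetaField hU F hF h6
  have hl7 : (7 : ℝ) ≤ l := by exact_mod_cast seven_le_of_prime_of_ne_five hl h5 hne
  have hη0 : 0 < η₀ := hη₀.1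
  obtain ⟨T⟩ := ThetaPartII.stub_thetaData P hP l hl h5 hcore hP2 hP5 h6
  have hgap := logQAvoid_le_of_cor312Slack T hU (h312w P hP d hPd l hl h5 hcore hP2 hP5 h6 h140 hlo hhi T)
    (ThetaPartII.hullVolume_of_hullRegime hreg P hP l hl h5 hcore hP2 hP5 h6 T)
  refine display_of_squeezeIII_slack_of_le_sharp hl h5 hne hη₀ le_rfl
    (le_trans (hTolw P hP d hPd l hl h5 hcore hP2 hP5 h6 h140 hlo hhi T) ?_) hgap
  have hc : (0 : ℝ) ≤ ((l : ℝ) + 1) / 4 := by positivity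
  have hcS : (0 : ℝ) ≤ 20 * (1 - 12 / (l : ℝ) ^ 2) - 84 / 9 := le_trans (by norm_num) (five_le_sharpCoeff hl7)
  exact mul_le_mul_of_nonneg_left (mul_le_mul_of_nonneg_left (by linarith) hcS) hc

end Summit.ABC.IUTFork.Conditional.Cor312Slack

end
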